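import Literature.Computability.Cryptography.LWEBinaryHybridZero
import Literature.Computability.Cryptography.ExtLWEChoiceReduction
import Literature.Computability.Cryptography.LWEFirstIsErrorlessZMod
import Literature.Computability.Cryptography.LWEDimensionExtension
import HarnessLib

/-!
# BLPRS 2013, Theorem 4.1 (`LWE_{k,·,q} ⇒ binLWE_{n,m,q}`): the advantage bookkeeping, with Lemma 4.7 as the one remaining hypothesis

Topic `Computability/Cryptography` (LWE), grouping namespace `LWE`. Proved assembly (no named fact) towards
`Literature.Computability.Cryptography.blprs_gapSVP_sqrt_dim_to_lwe_classical` (**pqc.S21**), hypothesis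
`h₃` of `BLPRSReduction.lean`: the printed proof of Thm. 4.1 chains Lemma 4.3 (`LWEFirstIsErrorlessZMod.lean`),
Lemma 4.7 (fel → extLWE; OPEN at measure level — its analytic ingredients are
`ContinuousGaussianMultivariate.lean`, `GaussianRoundingLaw.lean`, `BLPRSQualityReal.lean`), Lemma 4.8
(`ExtLWE.lean`, `ExtLWEChoiceReduction.lean`), Lemma 4.9 (`LWEBinaryHybrids/Zero/…`) and the trivial
dimension reduction (`LWEDimensionExtension.lean`):

> *"for any algorithm for `binLWE_{n,m,q,≤√(10n)α}` … we obtain algorithms for … whose advantages satisfy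
> … Lemma 4.9 provides three reductions … two from [extLWE^m] and one from `LWE_{k+1,m,q,√(5n)α}`,
> guaranteeing that the sum of advantages is at least the original advantage minus `4mε + δ`. … Lemma 4.8
> [loses a factor `m`], Lemma 4.7 [loses `33ε/2`], Lemma 4.3 [loses `∑_{p|q} p^{-k-1}`] … the trivial
> reduction from `LWE_{k,m,q,α}` to `LWE_{k+1,m,q,√(5n)α}` (which incurs no loss in advantage) …"*
> (arXiv:1306.0281, pp. 13 and 16–17, Thm. 4.1 with its proof).

In the tree's discrete `×q` model this file PROVES the whole bookkeeping from the landed lemmas, leaving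
Lemma 4.7 as the hypothesis `h47` in its natural discrete form (for every `z`-choosing `extLWE` adversary
there is a first-is-errorless distinguisher whose advantage is at least that of the former minus `L₄₇`,
for `z`-laws supported on binary vectors) and the first hybrid's one-dimensional noise closeness `hη`
(Lemma 2.9, `LWEBinaryNoiseCloseness.lean` discharges it for the Gaussian instantiation). The noise
raising of branch 2 (`α ↦ √(5n)α`, `LWENoiseConvolution.lean`) is left outside: branch 2 ends in
`LWE_{k,m,χ_h}`.

## Results

* `extLWEAdvantageZ_pure` — the `z`-choosing advantage at a point mass is the fixed-`z` advantage;
* **`blprs_theorem_4_1_bound`** — for every test `𝒜` on `binLWE` (`H₀`, `m` samples of dimension `n`,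
  secret law `ζ` on binary vectors, secret-dependent noise `χ₀`), there are `LWE_k` distinguishers
  `E₁, E₃` (on `m_fel` samples, noise `χ_src`) and `E₂` (on `m` samples, noise `χ_h`) with
  `Adv_{binLWE}[𝒜] ≤ mη + Δ_LHL + m (Adv[E₁] + ∑_{p|q} p^{-(k+1)} + L₄₇) + Adv[E₂] + m (Adv[E₃] + ∑_{p|q} p^{-(k+1)} + L₄₇)`.

## References

* Z. Brakerski, A. Langlois, C. Peikert, O. Regev, D. Stehlé, *Classical hardness of learning with errors*,
  STOC 2013; arXiv:1306.0281, Thm. 4.1 and its proof (pp. 13, 16–17), Lemmas 4.3, 4.7, 4.8, 4.9.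
-/

noncomputable section

open scoped ENNReal
open Matrix Literature.Probability.Distributions Literature.Algebra.Module

namespace Literature.Computability.Cryptography

namespace LWE

variable {R : Type} [CommRing R] [Fintype R] {k n : ℕ}

omit [Fintype R] in
/-- **The `z`-choosing advantage at a point mass `ζ = δ_z` is the fixed-`z` advantage** of the adversary
run with that `z`. [cite: BrakerskiEtAl2013, Def. 4.4] -/
theorem extLWEAdvantageZ_pure [Fintype R] (χ : PMF (Fin n → ℤ)) (t : ℕ) (z : Fin n → ℤ)
    (D : (Fin n → ℤ) × (Matrix (Fin k) (Fin n) R × (Fin t → (Fin n → R) × ℤ)) → PMF Bool) :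
    extLWEAdvantageZ (PMF.pure z) χ t D = extLWEAdvantage χ t z fun τ => D (z, τ) := by
  unfold extLWEAdvantageZ extLWERealZ extLWEIdealZ extLWEAdvantage acceptProb
  rw [PMF.pure_bind, PMF.pure_bind, PMF.bind_map, PMF.bind_map]
  rfl

variable {q : ℕ} [NeZero q]

/-- **BLPRS Thm. 4.1 — the advantage bookkeeping (discrete model, Lemma 4.7 as hypothesis `h47`).**
Parameters: source `LWE` dimension `k` (the `extLWE`/fel problems live in dimension `k + 1`), binary-secret
dimension `n`, `m` samples (`m ≥ 1`), `m_fel` noisy samples of the first-is-errorless problems, noise laws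
`χ_src` (source / fel), `χ_N` (`extLWE` integer noise columns), `χ_h` (branch 2), `χ₀` (the real noise of
`binLWE`, secret dependent), `z ← ζ` supported on binary vectors. Hypotheses: `hη` (first hybrid, Lemma 2.9)
and `h47` (Lemma 4.7: every `z`-choosing `extLWE_{k+1}` adversary, for a binary-supported law of `z`, is
matched by a fel distinguisher up to `L₄₇`). Conclusion: explicit-up-to-`h47` `LWE_k` distinguishers
`E₁, E₃` (`= felReduction ∘ …`, Lemma 4.3) and `E₂` (`= dimExtendThen 0 (shiftThen (hybridB₂ 𝒜))`) with the
printed shape of losses (`m·` from Lemma 4.8, `∑_{p|q} p^{-(k+1)}` from Lemma 4.3, `Δ_LHL = δ` from Lemma 2.2,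
`mη = 4mε` from Lemma 2.9). [cite: BrakerskiEtAl2013, Thm. 4.1 (proof)] -/
theorem blprs_theorem_4_1_bound (χ₀ : (Fin n → ZMod q) → PMF (ZMod q)) (χsrc χh : PMF (ZMod q))
    (χN : PMF (Fin n → ℤ)) (m mfel : ℕ) [NeZero m] (ζ : PMF (Fin n → ℤ))
    (hζ : ∀ z ∈ ζ.support, ∀ i, z i = 0 ∨ z i = 1) {η L47 : ℝ}
    (hη : ∀ z : Fin n → ℤ, (χ₀ (intCastVec z)).tvDist (noiseH₁ χN χh (intCastVec z)) ≤ η)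
    (h47 : ∀ ζ' : PMF (Fin n → ℤ), (∀ z ∈ ζ'.support, ∀ i, z i = 0 ∨ z i = 1) →
      ∀ D : (Fin n → ℤ) × (Matrix (Fin (k + 1)) (Fin n) (ZMod q) × (Fin 1 → (Fin n → ZMod q) × ℤ)) → PMF Bool,
        ∃ D' : ((Fin (k + 1) → ZMod q) × ZMod q) × (Fin mfel → (Fin (k + 1) → ZMod q) × ZMod q) → PMF Bool,
          extLWEAdvantageZ ζ' χN 1 D ≤ felAdvantage χsrc mfel D' + L47)
    (A : Distinguisher (Fin n) (ZMod q) m) :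
    ∃ (E₁ E₃ : Distinguisher (Fin k) (ZMod q) mfel) (E₂ : Distinguisher (Fin k) (ZMod q) m),
      |(acceptProb A (hybridH₀ χ₀ m ζ)).toReal - (acceptProb A (uniformSamples (Fin n) (ZMod q) m)).toReal| ≤
        m * η + (lawCz (k + 1) ζ).tvDist
            (PMF.uniformOfFintype (Matrix (Fin (k + 1)) (Fin n) (ZMod q) × (Fin (k + 1) → ZMod q))) +
          m * (distinguishingAdvantage χsrc mfel E₁ + ∑ p ∈ q.primeFactors, ((p : ℝ) ^ (k + 1))⁻¹ + L47) +
          distinguishingAdvantage χh m E₂ +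
          m * (distinguishingAdvantage χsrc mfel E₃ + ∑ p ∈ q.primeFactors, ((p : ℝ) ^ (k + 1))⁻¹ + L47) := by
  classical
  have hm0 : (0 : ℝ) ≤ m := Nat.cast_nonneg m
  -- Lemma 4.9 (full chain) at `extLWE` dimension `k + 1`
  have h49 := advantage_hybridH₀_le (k := k + 1) χ₀ χN χh m ζ hη A
  -- branch 1: Lemma 4.8 (z-choosing), Lemma 4.7 (hypothesis), Lemma 4.3
  set B₁ := hybridB₁ (k := k + 1) χh m A with hB₁
  have h48₁ := extLWEAdvantageZ_multiReduction ζ χN m B₁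
  obtain ⟨D₁, hD₁⟩ := h47 ζ hζ (extLWEMultiReductionZ χN m B₁)
  have h43₁ := felAdvantage_le_sum_primeFactors χsrc mfel D₁
  -- branch 2: the trivial dimension reduction `k + 1 → k`
  set B₂ := hybridB₂ (k := k + 1) χN m A with hB₂
  have hdim := distinguishingAdvantage_dimExtendThen_shiftThen χh (0 : ZMod q) m B₂
  -- branch 3: Lemma 4.8 (fixed `z = 0`), point mass, Lemma 4.7, Lemma 4.3
  set B₃ := hybridB₃ (k := k + 1) m A with hB₃
  have h48₃ := extLWEAdvantage_multiReduction χN m (0 : Fin n → ℤ) B₃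
  set B₃' := extLWEMultiReduction χN m (0 : Fin n → ℤ) B₃ with hB₃'
  have hpure := extLWEAdvantageZ_pure (R := ZMod q) χN 1 (0 : Fin n → ℤ)
    (fun p : (Fin n → ℤ) × (Matrix (Fin (k + 1)) (Fin n) (ZMod q) × (Fin 1 → (Fin n → ZMod q) × ℤ)) => B₃' p.2)
  have hζ0 : ∀ z ∈ (PMF.pure (0 : Fin n → ℤ)).support, ∀ i, z i = 0 ∨ z i = 1 := by
    intro z hz i
    rw [PMF.support_pure, Set.mem_singleton_iff] at hz
    exact Or.inl (by rw [hz]; rfl)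
  obtain ⟨D₃, hD₃⟩ := h47 (PMF.pure 0) hζ0 (fun p => B₃' p.2)
  rw [hpure] at hD₃
  have hD₃' : extLWEAdvantage χN 1 0 B₃' ≤ felAdvantage χsrc mfel D₃ + L47 := by simpa using hD₃
  have h43₃ := felAdvantage_le_sum_primeFactors χsrc mfel D₃
  refine ⟨felReduction (fun v : Fin (k + 1) → ZMod q => IsUnimodularVector v) unimodularCompletion mfel D₁,
    felReduction (fun v : Fin (k + 1) → ZMod q => IsUnimodularVector v) unimodularCompletion mfel D₃,
    dimExtendThen 0 (shiftThen m B₂), ?_⟩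
  -- bookkeeping
  have hT1 : extLWEAdvantageZ ζ χN m B₁ ≤
      m * (distinguishingAdvantage χsrc mfel
        (felReduction (fun v : Fin (k + 1) → ZMod q => IsUnimodularVector v) unimodularCompletion mfel D₁) +
        ∑ p ∈ q.primeFactors, ((p : ℝ) ^ (k + 1))⁻¹ + L47) := by
    rw [← h48₁]
    exact mul_le_mul_of_nonneg_left (by linarith) hm0
  have hT4 : extLWEAdvantage χN m 0 B₃ ≤
      m * (distinguishingAdvantage χsrc mfel
        (felReduction (fun v : Fin (k + 1) → ZMod q => IsUnimodularVector v) unimodularCompletion mfel D₃) +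
        ∑ p ∈ q.primeFactors, ((p : ℝ) ^ (k + 1))⁻¹ + L47) := by
    rw [← h48₃]
    exact mul_le_mul_of_nonneg_left (by linarith) hm0
  rw [hdim]
  linarith

end LWE

end Literature.Computability.Cryptography

end
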